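import Mathlib
import Literature.NumberTheory.LFunctions.Zhang2022.Section14MeanSquareMajorant
import Literature.NumberTheory.LFunctions.Zhang2022.SkeletonMeanValue
import HarnessLib

/-!
# Zhang (2022), Appendix A part 2 (i): `κ₁` at prime powers and the local factor `λ₁(q)` — kernel-checked

Topic `Literature/NumberTheory/LFunctions/Zhang2022` (Landau–Siegel audit tree; verdict-neutral).
Y. Zhang, *Discrete mean estimates and the Landau–Siegel zero*, arXiv:2211.02515v1 (2022)
[Zhang2022LandauSiegel] — **an unrefereed manuscript under adjudication**; this file PROVES finite,
per-prime algebraic identities and explicit-constant local estimates transcribed from its Appendix A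
("Some Euler products", pp. 104–106: the proofs of Lemmas 15.2 and 16.1) and asserts nothing about its
theorems. Campaign DAG nodes (cell siegel-zhang, `plan/DAG.tsv`): `Z22:§A.u022`, `Z22:§A.u023`,
`Z22:§A.u026`, `Z22:§A.u028`, `Z22:§A.u029` (proof of Lemma 15.2; the §16 analogues `Z22:§A.u033`–`u038`
are the sibling seat's, cell board RULING 4).
Companion: `AppendixALocalSeries.lean` (the series `κ̃₁(qʳ,1)`, the `r`-sum and the local form of
(A.6)/(A.7): nodes `Z22:§A.u020`, `Z22:§A.u024`, `Z22:§A.u025`, `Z22:§A.u027`).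

Notation of the source (App. A p. 101): `u = q⁻¹`, `v = χ(q)` (`q` prime, `χ` the real primitive
character mod `D`, so `v ∈ {−1, 0, 1}`); `β₁ = ib₁`, `β₂ = ib₂` ((2.13); the skeleton's `Skeleton.b1`,
`Skeleton.b2`); `κ₁` with `Σ κ₁(m)m⁻ˢ = ζ(s+β₁)ζ(s+β₂)/ζ(s)` (§15 p. 81) is the tree's
`MeanSquareMajorant.kappa₁ b₁ b₂ = n^{−ib₁} ∗ n^{−ib₂} ∗ μ`; `x := q^{−β₁} = powI b₁ q`,
`y := q^{−β₂} = powI b₂ q` (unimodular, `|x − 1| ≤ |b₁| log q`: `MeanSquareMajorant.norm_powI_sub_one_le`).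

## What is PROVED here (no hypothesis (A), no `sorry`, standard axioms; all constants explicit)

* `Z22:§A.u022` `kappa₁_prime_pow` — **`κ₁(qʳ) = Σ_{μ₁+μ₂=r} q^{−μ₁β₁−μ₂β₂} − Σ_{μ₁+μ₂=r−1} q^{−μ₁β₁−μ₂β₂}`**
  (`r ≥ 1`), and the rearrangement
  `κ₁(qʳ) − 1 = (xʳ − 1) + (y − 1)·Σ_{μ₁+μ₂=r−1} x^{μ₁}y^{μ₂}` (`kappa₁_prime_pow_sub_one`), which
  exhibits the cancellation behind the next item;
* `Z22:§A.u023` `norm_kappa₁_prime_pow_sub_one_le` — **`|κ₁(qʳ) − 1| ≤ r(|b₁|+|b₂|) log q`** for EVERY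
  `r ≥ 0` (the source: "`κ₁(qʳ) = 1 + O(αr log q)` if `qʳ < P`"; the size restriction is not needed);
* `Z22:§A.u028`, `Z22:§A.u029` `ident_A6_rational`, `ident_A7_rational` — the two "It is direct to verify
  that" identities **`1/(1−u) − uv(1−vu)/(1−u)² = (1−vq⁻¹)(1−vq⁻²)/((1−q⁻¹)(1−q⁻²))` for `v = ±1`** and
  **`= 1/(1−q⁻¹)` for `v = 0`**, as identities of rational functions (any field, `u ≠ ±1`);
* `Z22:§A.u026` `norm_lamOneLocal_sub_le` — **`λ₁(q) = 1 − vu + O(α log q/q)`** with the explicit bound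
  `|λ₁(q) − (1 − vu)| ≤ 4|u|(|x − 1| + |y − 1|) ≤ 4(|b₁|+|b₂|) log q/q`, where
  `λ₁(q) = (1−vux)(1−vuy)/(1−vu)` is the `q`-factor of (15.10) at `s = 1`.

Deliberately NOT here: (A.4) (the Euler product of `𝔪₁` with tail `1 + O(D^{−c})`, an analytic claim of
the manuscript), the general-`s` prefactor of (A.4) and the assembly of the product over `q < D` (the
`O(α₁)` of Lemma 15.2), Lemma 15.3 ("We give a sketch only") — companion files / typed CLAIM nodes.

## References

* Y. Zhang, arXiv:2211.02515v1 (2022), Appendix A pp. 104–106; §15 (15.10) p. 82; §16 (16.8) p. 91;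
  (2.13) p. 5. [cite: Zhang2022LandauSiegel, Appendix A]
-/

noncomputable section

open Finset Real Complex ArithmeticFunction

namespace Literature.NumberTheory.LFunctions.Zhang2022.AppendixALocal

open MeanSquareMajorant (powI powI_apply_of_ne_zero isMultiplicative_powI norm_powI_of_pos
  norm_powI_sub_one_le kappa₁ mul_apply_prime)

/-! ### §1. Unimodular powers: `|xⁿ − 1| ≤ n|x − 1|` -/

/-- For `‖x‖ ≤ 1`: `‖xⁿ − 1‖ ≤ n‖x − 1‖` (telescoping `x^{n+1} − 1 = x(xⁿ − 1) + (x − 1)`). (elementary step used implicitly at this point of the source)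
[cite: Zhang2022LandauSiegel, Appendix A p. 104 (proof of Lemma 15.2)] -/
theorem norm_pow_sub_one_le {x : ℂ} (hx : ‖x‖ ≤ 1) (n : ℕ) : ‖x ^ n - 1‖ ≤ n * ‖x - 1‖ := by
  induction n with
  | zero => simp
  | succ n ih =>
    have e : x ^ (n + 1) - 1 = x * (x ^ n - 1) + (x - 1) := by ring
    rw [e]
    calc ‖x * (x ^ n - 1) + (x - 1)‖ ≤ ‖x * (x ^ n - 1)‖ + ‖x - 1‖ := norm_add_le _ _
      _ ≤ 1 * (n * ‖x - 1‖) + ‖x - 1‖ := by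
          rw [norm_mul]; gcongr
      _ = (↑(n + 1) : ℝ) * ‖x - 1‖ := by push_cast; ring

/-- `powI b (m n) = powI b m · powI b n` for `m, n ≠ 0` (complete multiplicativity of `n ↦ n^{−ib}`).
(elementary step used implicitly at this point of the source)
[cite: Zhang2022LandauSiegel, Appendix A p. 104 (proof of Lemma 15.2)] -/
theorem powI_mul (b : ℝ) {m n : ℕ} (hm : m ≠ 0) (hn : n ≠ 0) :
    powI b (m * n) = powI b m * powI b n := by
  rw [powI_apply_of_ne_zero b (mul_ne_zero hm hn), powI_apply_of_ne_zero b hm,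
    powI_apply_of_ne_zero b hn, Nat.cast_mul, Complex.natCast_mul_natCast_cpow]

/-- `powI b (qᵏ) = (powI b q)ᵏ` for `q ≠ 0`. (elementary step used implicitly at this point of the source)
[cite: Zhang2022LandauSiegel, Appendix A p. 104 (proof of Lemma 15.2)] -/
theorem powI_prime_pow (b : ℝ) {q : ℕ} (hq : q ≠ 0) (k : ℕ) : powI b (q ^ k) = powI b q ^ k := by
  induction k with
  | zero => simp [(isMultiplicative_powI b).map_one]
  | succ k ih => rw [pow_succ, powI_mul b (pow_ne_zero k hq) hq, ih, pow_succ]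

/-- `‖powI b q‖ ≤ 1` (`= 1` for `q ≥ 1`, `= 0` at `q = 0`). (elementary step used implicitly at this point of the source)
[cite: Zhang2022LandauSiegel, Appendix A p. 104 (proof of Lemma 15.2)] -/
theorem norm_powI_le_one (b : ℝ) (q : ℕ) : ‖powI b q‖ ≤ 1 := by
  rcases Nat.eq_zero_or_pos q with h | h
  · subst h; simp
  · exact (norm_powI_of_pos b h).le

/-! ### §2. `κ₁` at prime powers (`Z22:§A.u022`, `Z22:§A.u023`) -/

/-- The complex Möbius function at a prime power `qʲ`, `j ≥ 1`: `−1` if `j = 1`, else `0`. (elementary step used implicitly at this point of the source)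
[cite: Zhang2022LandauSiegel, Appendix A p. 104 (proof of Lemma 15.2)] -/
theorem moebius_complex_apply_prime_pow {q : ℕ} (hq : q.Prime) {j : ℕ} (hj : j ≠ 0) :
    (ArithmeticFunction.moebius : ArithmeticFunction ℂ) (q ^ j) = if j = 1 then -1 else 0 := by
  rw [ArithmeticFunction.intCoe_apply, ArithmeticFunction.moebius_apply_prime_pow hq hj]
  split_ifs <;> simp

/-- `(f ∗ μ)(qʳ) = f(qʳ) − f(q^{r−1})` for a prime `q` and `r ≥ 1`. (elementary step used implicitly at this point of the source)
[cite: Zhang2022LandauSiegel, Appendix A p. 104 (proof of Lemma 15.2)] -/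
theorem mul_moebius_apply_prime_pow (f : ArithmeticFunction ℂ) {q : ℕ} (hq : q.Prime) {r : ℕ}
    (hr : 1 ≤ r) :
    (f * (ArithmeticFunction.moebius : ArithmeticFunction ℂ)) (q ^ r) = f (q ^ r) - f (q ^ (r - 1)) := by
  rw [RankinEisenstein.mul_apply_prime_pow _ _ hq]
  have hmem_r : r ∈ range (r + 1) := by simp
  have hmem_r1 : r - 1 ∈ range (r + 1) := by simp only [mem_range]; omega
  rw [Finset.sum_eq_add_of_mem (r - 1) r hmem_r1 hmem_r (by omega)]
  · have h1 : r - (r - 1) = 1 := by omega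
    rw [h1, Nat.sub_self, pow_zero, pow_one, moebius_complex_apply_prime hq]
    have : (ArithmeticFunction.moebius : ArithmeticFunction ℂ) 1 = 1 := by
      rw [ArithmeticFunction.intCoe_apply, ArithmeticFunction.moebius_apply_one, Int.cast_one]
    rw [this]; ring
  · intro c hc hne
    have hc' : c < r - 1 := by
      have := mem_range.mp hc
      omega
    have hj : r - c ≠ 0 := by omega
    have hj1 : r - c ≠ 1 := by omega
    rw [moebius_complex_apply_prime_pow hq hj, if_neg hj1, mul_zero]

/-- `(powI b₁ ∗ powI b₂)(qᵏ) = Σ_{μ₁+μ₂=k} q^{−μ₁β₁}q^{−μ₂β₂}`. (elementary step used implicitly at this point of the source)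
[cite: Zhang2022LandauSiegel, Appendix A p. 104 (proof of Lemma 15.2)] -/
theorem powI_mul_powI_prime_pow (b₁ b₂ : ℝ) {q : ℕ} (hq : q.Prime) (k : ℕ) :
    (powI b₁ * powI b₂) (q ^ k) =
      ∑ i ∈ range (k + 1), powI b₁ q ^ i * powI b₂ q ^ (k - i) := by
  rw [RankinEisenstein.mul_apply_prime_pow _ _ hq]
  refine sum_congr rfl fun i _ => ?_
  rw [powI_prime_pow b₁ hq.ne_zero, powI_prime_pow b₂ hq.ne_zero]

/-- The recursion `S_{r+1}(x,y) = x^{r+1} + y·S_r(x,y)` for the complete homogeneous sums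
`S_k(x,y) = Σ_{μ₁+μ₂=k} x^{μ₁}y^{μ₂}` (the source's "`μ₁, μ₂` run through non-negative integers").
(elementary step used implicitly at this point of the source)
[cite: Zhang2022LandauSiegel, Appendix A p. 104 (proof of Lemma 15.2)] -/
theorem homSum_succ (x y : ℂ) (r : ℕ) :
    ∑ i ∈ range (r + 1 + 1), x ^ i * y ^ (r + 1 - i) =
      x ^ (r + 1) + y * ∑ i ∈ range (r + 1), x ^ i * y ^ (r - i) := by
  rw [sum_range_succ, Nat.sub_self, pow_zero, mul_one, mul_sum, add_comm]
  congr 1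
  refine sum_congr rfl fun i hi => ?_
  have hi' : i ≤ r := Nat.lt_succ_iff.mp (mem_range.mp hi)
  have e : r + 1 - i = (r - i) + 1 := by omega
  rw [e, pow_succ]; ring

/-- `‖S_k(x,y)‖ ≤ k + 1` for `‖x‖, ‖y‖ ≤ 1`. (elementary step used implicitly at this point of the source)
[cite: Zhang2022LandauSiegel, Appendix A p. 104 (proof of Lemma 15.2)] -/
theorem norm_homSum_le {x y : ℂ} (hx : ‖x‖ ≤ 1) (hy : ‖y‖ ≤ 1) (k : ℕ) :
    ‖∑ i ∈ range (k + 1), x ^ i * y ^ (k - i)‖ ≤ k + 1 := by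
  calc ‖∑ i ∈ range (k + 1), x ^ i * y ^ (k - i)‖ ≤ ∑ i ∈ range (k + 1), ‖x ^ i * y ^ (k - i)‖ :=
        norm_sum_le _ _
    _ ≤ ∑ _i ∈ range (k + 1), (1 : ℝ) := sum_le_sum fun i _ => by
        rw [norm_mul, norm_pow, norm_pow]
        exact mul_le_one₀ (pow_le_one₀ (norm_nonneg _) hx) (by positivity)
          (pow_le_one₀ (norm_nonneg _) hy)
    _ = k + 1 := by simp

/-- **`Z22:§A.u022`**: `κ₁(qʳ) = Σ_{μ₁+μ₂=r} q^{−μ₁β₁−μ₂β₂} − Σ_{μ₁+μ₂=r−1} q^{−μ₁β₁−μ₂β₂}` for a prime `q`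
and `r ≥ 1`. [cite: Zhang2022LandauSiegel, Appendix A p. 104 (proof of Lemma 15.2)] -/
theorem kappa₁_prime_pow (b₁ b₂ : ℝ) {q : ℕ} (hq : q.Prime) {r : ℕ} (hr : 1 ≤ r) :
    kappa₁ b₁ b₂ (q ^ r) =
      (∑ i ∈ range (r + 1), powI b₁ q ^ i * powI b₂ q ^ (r - i)) -
        ∑ i ∈ range (r - 1 + 1), powI b₁ q ^ i * powI b₂ q ^ (r - 1 - i) := by
  rw [kappa₁, mul_moebius_apply_prime_pow _ hq hr, powI_mul_powI_prime_pow b₁ b₂ hq,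
    powI_mul_powI_prime_pow b₁ b₂ hq]

/-- The cancellation behind `Z22:§A.u023`: `κ₁(qʳ) − 1 = (xʳ − 1) + (y − 1)·S_{r−1}(x,y)` (`r ≥ 1`,
`x = q^{−β₁}`, `y = q^{−β₂}`). [cite: Zhang2022LandauSiegel, Appendix A p. 104] -/
theorem kappa₁_prime_pow_sub_one (b₁ b₂ : ℝ) {q : ℕ} (hq : q.Prime) {r : ℕ} (hr : 1 ≤ r) :
    kappa₁ b₁ b₂ (q ^ r) - 1 =
      (powI b₁ q ^ r - 1) +
        (powI b₂ q - 1) * ∑ i ∈ range (r - 1 + 1), powI b₁ q ^ i * powI b₂ q ^ (r - 1 - i) := by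
  obtain ⟨k, rfl⟩ : ∃ k, r = k + 1 := ⟨r - 1, by omega⟩
  rw [kappa₁_prime_pow b₁ b₂ hq hr, Nat.add_sub_cancel, homSum_succ]
  ring

/-- **`Z22:§A.u023`** with an explicit constant and no size restriction: **`|κ₁(qʳ) − 1| ≤ r(|b₁| + |b₂|) log q`**
for every prime `q` and every `r` (the source: "`κ₁(qʳ) = 1 + O(αr log q)` if `qʳ < P`", with
`|b₁|, |b₂| ≤ 3α`). [cite: Zhang2022LandauSiegel, Appendix A p. 104 (proof of Lemma 15.2)] -/
theorem norm_kappa₁_prime_pow_sub_one_le (b₁ b₂ : ℝ) {q : ℕ} (hq : q.Prime) (r : ℕ) :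
    ‖kappa₁ b₁ b₂ (q ^ r) - 1‖ ≤ r * ((|b₁| + |b₂|) * Real.log q) := by
  rcases Nat.eq_zero_or_pos r with h0 | hr
  · subst h0
    simp [(MeanSquareMajorant.isMultiplicative_kappa₁ b₁ b₂).map_one]
  have hx := norm_powI_le_one b₁ q
  have hy := norm_powI_le_one b₂ q
  have hx1 := norm_powI_sub_one_le b₁ hq.pos
  have hy1 := norm_powI_sub_one_le b₂ hq.pos
  have hlog : 0 ≤ Real.log q := Real.log_natCast_nonneg q
  rw [kappa₁_prime_pow_sub_one b₁ b₂ hq hr]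
  have hS := norm_homSum_le hx hy (r - 1)
  have hr' : ((r - 1 : ℕ) : ℝ) + 1 = r := by
    rw [Nat.cast_sub hr]; push_cast; ring
  rw [hr'] at hS
  calc ‖(powI b₁ q ^ r - 1) +
        (powI b₂ q - 1) * ∑ i ∈ range (r - 1 + 1), powI b₁ q ^ i * powI b₂ q ^ (r - 1 - i)‖
      ≤ ‖powI b₁ q ^ r - 1‖ +
        ‖(powI b₂ q - 1) * ∑ i ∈ range (r - 1 + 1), powI b₁ q ^ i * powI b₂ q ^ (r - 1 - i)‖ :=
        norm_add_le _ _
    _ ≤ r * ‖powI b₁ q - 1‖ + ‖powI b₂ q - 1‖ * r := by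
        rw [norm_mul]
        gcongr
        exact norm_pow_sub_one_le hx r
    _ ≤ r * (|b₁| * Real.log q) + (|b₂| * Real.log q) * r := by gcongr
    _ = r * ((|b₁| + |b₂|) * Real.log q) := by ring

/-! ### §3. The two rational identities (`Z22:§A.u028`, `Z22:§A.u029`) -/

/-- **`Z22:§A.u028`** ("It is direct to verify that"): for `v = ±1` (`χ(q) ≠ 0`),
`1/(1−u) − uv(1−vu)/(1−u)² = (1−vu)(1−vu²)/((1−u)(1−u²))`, i.e. the right side of (A.6)
`(1−χ(q)q⁻¹)(1−χ(q)q⁻²)/((1−q⁻¹)(1−q⁻²))`. An identity of rational functions (`u ≠ ±1`).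
[cite: Zhang2022LandauSiegel, Appendix A p. 105 (proof of Lemma 15.2)] -/
theorem ident_A6_rational {K : Type*} [Field K] {u v : K} (hv : v = 1 ∨ v = -1) (hu : u ≠ 1)
    (hu' : u ≠ -1) :
    1 / (1 - u) - u * v * (1 - v * u) / (1 - u) ^ 2 =
      (1 - v * u) * (1 - v * u ^ 2) / ((1 - u) * (1 - u ^ 2)) := by
  have h1 : (1 - u) ≠ 0 := sub_ne_zero.mpr (Ne.symm hu)
  have h2 : (1 + u) ≠ 0 := by
    intro h; apply hu'; linear_combination h
  have h3 : (1 - u ^ 2) ≠ 0 := by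
    have : 1 - u ^ 2 = (1 - u) * (1 + u) := by ring
    rw [this]; exact mul_ne_zero h1 h2
  rcases hv with rfl | rfl
  · field_simp
  · field_simp
    ring

/-- **`Z22:§A.u029`**: for `v = 0` (`q ∣ D`), `1/(1−u) − uv(1−vu)/(1−u)² = 1/(1−q⁻¹)`, the right side of
(A.7). [cite: Zhang2022LandauSiegel, Appendix A p. 105 (proof of Lemma 15.2)] -/
theorem ident_A7_rational {K : Type*} [Field K] (u : K) :
    1 / (1 - u) - u * 0 * (1 - 0 * u) / (1 - u) ^ 2 = 1 / (1 - u) := by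
  simp

/-! ### §4. The local factor `λ₁(q)` (`Z22:§A.u026`) -/

/-- `‖1 − vu‖ ≥ 1/2` for `|v| ≤ 1`, `|u| ≤ 1/2`. (elementary step used implicitly at this point of the source)
[cite: Zhang2022LandauSiegel, Appendix A p. 104 (proof of Lemma 15.2)] -/
theorem half_le_norm_one_sub {u v : ℂ} (hu : ‖u‖ ≤ 1 / 2) (hv : ‖v‖ ≤ 1) :
    1 / 2 ≤ ‖1 - v * u‖ := by
  have h1 : ‖v * u‖ ≤ 1 / 2 := by
    rw [norm_mul]
    calc ‖v‖ * ‖u‖ ≤ 1 * (1 / 2) := by gcongr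
      _ = 1 / 2 := by ring
  have h2 : ‖(1 : ℂ)‖ - ‖v * u‖ ≤ ‖1 - v * u‖ := norm_sub_norm_le _ _
  rw [norm_one] at h2
  linarith

/-- `1 − vu ≠ 0` for `|v| ≤ 1`, `|u| ≤ 1/2`. (elementary step used implicitly at this point of the source)
[cite: Zhang2022LandauSiegel, Appendix A p. 104 (proof of Lemma 15.2)] -/
theorem one_sub_ne_zero {u v : ℂ} (hu : ‖u‖ ≤ 1 / 2) (hv : ‖v‖ ≤ 1) : (1 : ℂ) - v * u ≠ 0 := by
  intro h
  have := half_le_norm_one_sub hu hv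
  rw [h, norm_zero] at this
  linarith

/-- **`Z22:§A.u026`**: **`λ₁(q) = 1 − vu + O(α log q/q)`**, quantitatively
`‖λ₁(q) − (1 − vu)‖ ≤ 4|u|(‖x − 1‖ + ‖y − 1‖)` for `|v| ≤ 1`, `|u| ≤ 1/2`, `‖x‖, ‖y‖ ≤ 1`, where
`λ₁(q) = (1−vux)(1−vuy)/(1−vu)` is the `q`-factor of (15.10) at `s = 1` (`u = q⁻¹`, `v = χ(q)`,
`x = q^{−β₁}`, `y = q^{−β₂}`: `‖x − 1‖ ≤ |b₁| log q`, `‖y − 1‖ ≤ |b₂| log q` by `norm_powI_sub_one_le`).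
[cite: Zhang2022LandauSiegel, Appendix A p. 104 (proof of Lemma 15.2)] -/
theorem norm_lamOneLocal_sub_le {u v x y : ℂ} (hu : ‖u‖ ≤ 1 / 2) (hv : ‖v‖ ≤ 1)
    (hx : ‖x‖ ≤ 1) (hy : ‖y‖ ≤ 1) :
    ‖(1 - v * u * x) * (1 - v * u * y) / (1 - v * u) - (1 - v * u)‖ ≤
      4 * ‖u‖ * (‖x - 1‖ + ‖y - 1‖) := by
  have hne := one_sub_ne_zero hu hv
  have hden := half_le_norm_one_sub hu hv
  set a : ℂ := v * u with ha
  have hna : ‖a‖ ≤ ‖u‖ := by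
    rw [ha, norm_mul]
    calc ‖v‖ * ‖u‖ ≤ 1 * ‖u‖ := by gcongr
      _ = ‖u‖ := one_mul _
  have e : (1 - a * x) * (1 - a * y) / (1 - a) - (1 - a) =
      (-(a * (1 - a) * ((x - 1) + (y - 1))) + a ^ 2 * ((x - 1) * (y - 1))) / (1 - a) := by
    rw [eq_div_iff hne]
    field_simp
    ring
  clear_value a
  rw [e, norm_div]
  have hx2 : ‖x - 1‖ ≤ 2 := by
    calc ‖x - 1‖ ≤ ‖x‖ + ‖(1 : ℂ)‖ := norm_sub_le _ _
      _ ≤ 1 + 1 := by rw [norm_one]; gcongr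
      _ = 2 := by norm_num
  have hy2 : ‖y - 1‖ ≤ 2 := by
    calc ‖y - 1‖ ≤ ‖y‖ + ‖(1 : ℂ)‖ := norm_sub_le _ _
      _ ≤ 1 + 1 := by rw [norm_one]; gcongr
      _ = 2 := by norm_num
  have hxy : ‖(x - 1) * (y - 1)‖ ≤ ‖x - 1‖ + ‖y - 1‖ := by
    rw [norm_mul]
    nlinarith [mul_le_mul_of_nonneg_right hx2 (norm_nonneg (y - 1)),
      mul_le_mul_of_nonneg_left hy2 (norm_nonneg (x - 1)), norm_nonneg (x - 1), norm_nonneg (y - 1)]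
  have hu0 : 0 ≤ ‖u‖ := norm_nonneg u
  have h1a : ‖1 - a‖ ≤ 1 + ‖u‖ := by
    calc ‖1 - a‖ ≤ ‖(1 : ℂ)‖ + ‖a‖ := norm_sub_le _ _
      _ ≤ 1 + ‖u‖ := by rw [norm_one]; gcongr
  have hnum : ‖-(a * (1 - a) * ((x - 1) + (y - 1))) + a ^ 2 * ((x - 1) * (y - 1))‖ ≤
      (‖u‖ * (1 + ‖u‖) + ‖u‖ ^ 2) * (‖x - 1‖ + ‖y - 1‖) := by
    calc ‖-(a * (1 - a) * ((x - 1) + (y - 1))) + a ^ 2 * ((x - 1) * (y - 1))‖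
        ≤ ‖-(a * (1 - a) * ((x - 1) + (y - 1)))‖ + ‖a ^ 2 * ((x - 1) * (y - 1))‖ := norm_add_le _ _
      _ = ‖a‖ * ‖1 - a‖ * ‖(x - 1) + (y - 1)‖ + ‖a‖ ^ 2 * ‖(x - 1) * (y - 1)‖ := by
          rw [norm_neg, norm_mul, norm_mul, norm_mul, norm_pow]
      _ ≤ ‖u‖ * (1 + ‖u‖) * (‖x - 1‖ + ‖y - 1‖) + ‖u‖ ^ 2 * (‖x - 1‖ + ‖y - 1‖) := by
          gcongr
          exact norm_add_le _ _
      _ = (‖u‖ * (1 + ‖u‖) + ‖u‖ ^ 2) * (‖x - 1‖ + ‖y - 1‖) := by ring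
  have hS : 0 ≤ ‖x - 1‖ + ‖y - 1‖ := by positivity
  calc ‖-(a * (1 - a) * ((x - 1) + (y - 1))) + a ^ 2 * ((x - 1) * (y - 1))‖ / ‖1 - a‖
      ≤ (‖u‖ * (1 + ‖u‖) + ‖u‖ ^ 2) * (‖x - 1‖ + ‖y - 1‖) / (1 / 2) := by
        gcongr
    _ = 2 * (‖u‖ * (1 + ‖u‖) + ‖u‖ ^ 2) * (‖x - 1‖ + ‖y - 1‖) := by ring
    _ ≤ 4 * ‖u‖ * (‖x - 1‖ + ‖y - 1‖) := by
        apply mul_le_mul_of_nonneg_right _ hS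
        nlinarith

/-- `‖q⁻¹‖ ≤ 1/2` in `ℂ` for `q ≥ 2`. (elementary step used implicitly at this point of the source)
[cite: Zhang2022LandauSiegel, Appendix A p. 104 (proof of Lemma 15.2)] -/
theorem norm_inv_natCast_le_half {q : ℕ} (hq : 2 ≤ q) : ‖(q : ℂ)⁻¹‖ ≤ 1 / 2 := by
  have hq' : (2 : ℝ) ≤ q := by exact_mod_cast hq
  rw [norm_inv, Complex.norm_natCast, one_div]
  exact inv_anti₀ (by norm_num) hq'

/-- `‖q⁻¹‖ = q⁻¹` in `ℂ`. (elementary step used implicitly at this point of the source)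
[cite: Zhang2022LandauSiegel, Appendix A p. 104 (proof of Lemma 15.2)] -/
theorem norm_inv_natCast (q : ℕ) : ‖(q : ℂ)⁻¹‖ = (q : ℝ)⁻¹ := by
  rw [norm_inv, Complex.norm_natCast]

end Literature.NumberTheory.LFunctions.Zhang2022.AppendixALocal
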